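import Summits.CriticalPhenomena.PercolationContinuityZ3.Theses.PercDebrisSweep
import Literature.Probability.Percolation.SharpnessDCT
import Literature.Probability.Percolation.CriticalContinuityProofs

/-!
# Birth skeleton (BC3) for the crux `SubcritChiBelowCube` (stmt-CriticalPhenomena-0942)

Routes `route-CriticalPhenomena-PercDebrisSweep` (primary, crux rank 2) and
`route-CriticalPhenomena-PercLevelPieceIsoperimetry` (rank 3; shared item), sub-problem
`PercolationContinuityZ3`; crux decl
`Summit.CriticalPhenomena.PercolationContinuityZ3.Theses.PercDebrisSweep.SubcritChiBelowCube`: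
(S) `∃ γ < 3, C : ∀ p < p_c(ℤ³), ∀ R, Σ_{x ∈ Λ_R} τ_p(0,x) ≤ C (p_c − p)^{−γ}` — the susceptibility
`χ(p) = E_p|C(0)|` of bond percolation on `ℤ³` diverges no faster than `(p_c − p)^{−γ}` for some
`γ < 3` (uniform bound on the partial sums `χ_R(p) := Σ_{x ∈ Λ_R} τ_p(0,x)`).

THE LINE ("finite-size criterion at sub-cubic volume", the route header's own candidate split
child "ν₀ < 1 for the correlation length", typed in the weakest form the assembly needs). Write
`φ_p(S) := p · Σ_{y ∈ S} Σ_{z ∉ S, z ∼ y} P_p[0 ↔ y in S]` for the Duminil-Copin–Tassion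
finite-size functional (`Literature.Probability.Percolation.DCT16.phi`, in tree with its whole
2016 sharpness machinery, `SharpnessDCT(Proofs).lean`, and the DKT 2020 layer
`CorrelationLengthDKT*.lean`). Two registered stubs:

* STUB 1 `stub_simonLieb` (L, PROVABLE NOW — the known reduction): **Simon–Lieb / DCT bound of
  the susceptibility by a criterion set** — for every `p`, every finite `S ∋ 0` and `η > 0`,
  `φ_p(S) ≤ 1 − η ⟹ ∀ R, χ_R(p) ≤ |S| / η`. Proof on paper (Simon 1980 for Ising; for percolation
  the two-point version of Duminil-Copin–Tassion 2016 §2.1, arXiv:1502.03051): for `x ∉ S`, the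
  last exit of an open path `0 → x` from the cluster `𝒞 = {z : 0 ↔ z in S}` gives
  `τ_p(0,x) ≤ p Σ_{y ∈ S, z ∉ S, z∼y} P_p[0 ↔ y in S] τ_p(z,x)` (decouple on `{𝒞 = C}` exactly as
  `DCT16.exists_decomposition` / `real_inter_three` do for the one-arm event); summing `x` over a
  TRANSLATED box `a + Λ_R` and using translation invariance of `τ_p`, the finite quantity
  `M_R := sup_a Σ_{x ∈ a+Λ_R} τ_p(0,x) (≤ |Λ_R|)` obeys `M_R ≤ |S| + φ_p(S) M_R`, whence
  `χ_R(p) ≤ M_R ≤ |S|/η`. True for EVERY `p` (no `p < p_c` needed: `φ_p(S) < 1` itself forces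
  subcriticality). Not in tree (checked: only the one-arm consequences
  `real_siteToBoundary_le_phi_mul`, `real_siteToBoundary_le_phi_pow_div` are).
* STUB 2 `stub_criterionVolume` (XL, OPEN — LOAD-BEARING): **criterion sets of sub-cubic
  volume** — `∃ γ₀ < 3, η > 0, C : ∀ p < p_c, ∃ finite S ∋ 0` with `|S| ≤ C (p_c − p)^{−γ₀}` and
  `φ_p(S) ≤ 1 − η`. Informally: the DCT finite-size criterion is met, with a fixed margin, on a
  set of volume `O((p_c − p)^{−γ₀})`, `γ₀ < 3`. With boxes `S = Λ_{L(p)}` this is the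
  finite-size correlation-length exponent statement `L(p) ≤ C (p_c − p)^{−ν₀}`, `ν₀ < 1`
  (`CriterionBoxScaleBelowOne`, PROVED below to imply STUB 2: `criterionVolume_of_boxScale`,
  `|Λ_L| = (2L+1)³`); numerics `ν = 0.876`, so `3ν ≈ 2.63 < 3` — the real-world margin of the
  line. Why it might fail / why it is open: no polynomial bound on any correlation length is known
  on `ℤ^d`, `3 ≤ d ≤ 6` (only `ξ_p ≤ exp(C (p_c − p)^{−2})`, DKT 2020 Thm 2 =
  `DuminilcopinKozmaTassion2020_thm2_subcritical`); in a jump world `θ(p_c) > 0` Newman 1986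
  forces `γ ≥ 2`, and STUB 1 + STUB 2 give `γ ≤ γ₀`, so the content is the window `γ₀ ∈ [2,3)`
  exactly as for the crux (no soft contradiction: a criterion set at `p = p_c − ε` only has to
  satisfy `φ_p(S) ≥ P_p(C(0) ⊄ S) ≥ 3θ*/4`, compatible with `φ_p(S) ≤ 1 − η` for small `θ*`).
  STUB 2 is NOT implied by the crux (from `χ(p) ≤ C t^{−γ}` one only gets criterion BOXES at
  scale `L ≤ 6χ`, volume `O(t^{−3γ})`, and `γ ≥ 1` by Aizenman–Newman) — it is the genuinely
  stronger, single-scale, finite-volume form ("transfer" `C⁺`): `φ_p(S)` is a polynomial in `p`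
  for each finite `S`, the natural input of every quantitative sharpness argument on `ℤ³`
  (DCT 2016, DKT 2020 `p_n`-scheme, OSSS), and it never mentions the infinite-volume sum `χ`.

Composition (kernel-checked, no `sorry`): `SubcritChiBelowCube_of : stub_simonLieb →
stub_criterionVolume → SubcritChiBelowCube` (hypotheses typed by the name-keyed aliases
`__Registered.stub_*`): `χ_R(p) ≤ |S(p)|/η ≤ (C/η) (p_c − p)^{−γ₀}`, witness `(γ, C') = (γ₀, C/η)`.
All the percolation content sits in the two stubs; the seam is Simon–Lieb's inequality.

DISPROOF USED: none exists for this crux (`ledger crux ls stmt-CriticalPhenomena-0942`: no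
workfiles, no `Disproof.lean`, no landed Negative lemma, 2026-08-17). Negatives index of the
summit (11 entries, 2026-08-17): nothing on `χ`, `φ_p(S)`, `ξ` or exponents — not touched.
Degenerate instances excluded by typing: `0 ∈ S` is REQUIRED in both stubs (for `0 ∉ S` the
event `{0 ↔ y in S}` is empty and `φ_p(S) = 0`, which would make STUB 2 vacuous and STUB 1 false);
the base `p_c − p` of the real power lies in `(0, 1]` for `p < p_c` (`0 < p_c < 1` in tree:
`criticalProb_zd_pos`, `criticalProb_zd_lt_one`), so there is no `rpow` junk; `η > 1` makes the
hypothesis `φ ≤ 1 − η < 0` unsatisfiable (`DCT16.phi_nonneg`), harmless.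
-/

noncomputable section

namespace Summit.CriticalPhenomena.PercolationContinuityZ3.Cruxes.SubcritChiBelowCube.Birth

open MeasureTheory Filter Literature.Probability.Percolation Literature.Probability.LatticeModels
open Summit.CriticalPhenomena.PercolationContinuityZ3.Theses.PercDebrisSweep (SubcritChiBelowCube)

/-! ## Objects of the line -/

/-- `p_c(ℤ³)` as a real number (the crux's `criticalProb (zdGraph 3) 0`; `= criticalProbI 3`). -/
abbrev pc : ℝ := criticalProb (zdGraph 3) (0 : Site 3)

/-- The truncated susceptibility `χ_R(p) := Σ_{x ∈ Λ_R} τ_p(0,x)` — verbatim the partial sum of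
the crux (`τ_p(0,x) = (bondPercolation (zdGraph 3) p).real (openConn 0 x)`, `tau_def`). -/
def chiR (p : unitInterval) (R : ℕ) : ℝ :=
  ∑ x ∈ box 3 R, (bondPercolation (zdGraph 3) p).real (openConn (0 : Site 3) x)

/-- The crux is literally `∃ γ < 3, C, ∀ p < p_c, ∀ R, χ_R(p) ≤ C (p_c − p)^{−γ}`. -/
theorem subcritChiBelowCube_iff :
    SubcritChiBelowCube ↔ ∃ γ C : ℝ, γ < 3 ∧ ∀ p : unitInterval, (p : ℝ) < pc → ∀ R : ℕ,
      chiR p R ≤ C * (pc - (p : ℝ)) ^ (-γ) := Iff.rfl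

/-! ## The two stub statements -/

/-- STUB 1 statement (Simon–Lieb / Duminil-Copin–Tassion): a finite set `S ∋ 0` on which the
finite-size functional satisfies `φ_p(S) ≤ 1 − η` bounds every partial sum of the two-point
function: `χ_R(p) ≤ |S| / η` for all `R`. -/
def SimonLiebBound : Prop :=
  ∀ (p : unitInterval) (S : Finset (Site 3)) (η : ℝ), (0 : Site 3) ∈ S → 0 < η →
    DCT16.phi p S ≤ 1 - η → ∀ R : ℕ, chiR p R ≤ (S.card : ℝ) / η

/-- STUB 2 statement (LOAD-BEARING): criterion sets of sub-cubic volume — there are `γ₀ < 3`,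
`η > 0`, `C` such that for every `p < p_c` some finite `S ∋ 0` has `|S| ≤ C (p_c − p)^{−γ₀}` and
`φ_p(S) ≤ 1 − η`. -/
def CriterionVolumeBelowCube : Prop :=
  ∃ γ₀ η C : ℝ, γ₀ < 3 ∧ 0 < η ∧ ∀ p : unitInterval, (p : ℝ) < pc →
    ∃ S : Finset (Site 3), (0 : Site 3) ∈ S ∧ (S.card : ℝ) ≤ C * (pc - (p : ℝ)) ^ (-γ₀) ∧
      DCT16.phi p S ≤ 1 - η

/-- The correlation-length form of STUB 2 (route header: "alternative stronger form … ν₀ < 1 for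
the correlation length"): the DCT criterion holds on the BOX `Λ_{L(p)}` at a scale
`L(p) ≤ C (p_c − p)^{−ν₀}` with `0 ≤ ν₀ < 1` (finite-size correlation-length exponent below one).
It implies STUB 2 with `γ₀ = 3ν₀` (`criterionVolume_of_boxScale`). Not registered as a stub (it is
an entry point for provers of STUB 2, not a hypothesis of the composition). -/
def CriterionBoxScaleBelowOne : Prop :=
  ∃ ν₀ η C : ℝ, 0 ≤ ν₀ ∧ ν₀ < 1 ∧ 0 < η ∧ ∀ p : unitInterval, (p : ℝ) < pc →
    ∃ L : ℕ, (L : ℝ) ≤ C * (pc - (p : ℝ)) ^ (-ν₀) ∧ DCT16.phi p (box 3 L) ≤ 1 - η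

/-! ## Registered stubs -/

/-- **STUB 1 `simonLieb`** (L, PROVABLE NOW): `0 ∈ S`, `0 < η`, `φ_p(S) ≤ 1 − η ⟹ ∀ R,
χ_R(p) ≤ |S|/η`. Proof sketch: (i) two-point decomposition `τ_p(0,x) ≤ p Σ_{y∈S, z∉S, z∼y}
P_p[0 ↔ y in S] · τ_p(z,x)` for `x ∉ S` (last exit from `𝒞 = {z : 0 ↔ z in S}`; on `{𝒞 = C}` the
three events `{𝒞 = C}`, `{yz open}`, `{z ↔ x off C}` use disjoint edge sets — the pattern of
`DCT16.exists_decomposition` / `real_inter_three` / `sum_real_clusterEvent` in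
`SharpnessDCTProofs.lean`, with `exitEvent` replaced by `{z ↔ x in ℤ³ ∖ C} ⊆ {z ↔ x}`);
(ii) translation invariance `τ_p(z,x) = τ_p(0,x−z)` (cf. `preimage_shift_siteToBoundary`,
`real_armEvent`, `tsum_tau_left_eq_chi`); (iii) with `M_R := sup_{a ∈ ℤ³} Σ_{x ∈ a + Λ_R} τ_p(0,x)`
(a real number `≤ |Λ_R|`), summing (i) over `x ∈ a + Λ_R` gives `M_R ≤ |S| + φ_p(S) M_R`, so
`χ_R(p) ≤ M_R ≤ |S|/η`. Sources: Grimmett 1999 §6.2 (6.68) p.131 (the BK form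
`τ_p(0,z) ≤ Σ_{x ∈ ∂S(m)} τ_p(0,x) τ_p(x,z)`, "sometimes named after Simon (1980) and Lieb (1980)",
§6.5 notes p.144; held text read); Simon 1980 / Lieb 1980 (Commun. Math. Phys. 77, 111–126 /
127–135, the Ising originals); Duminil-Copin–Tassion 2016 (arXiv:1502.03051 §2.1: the `φ_p(S)`
refinement with `P_p[0 ↔ y in S]` and the factor `p`, proved there for the one-arm event). -/
theorem stub_simonLieb : SimonLiebBound := by
  sorry

/-- **STUB 2 `criterionVolume`** (XL, OPEN — LOAD-BEARING): `∃ γ₀ < 3, η > 0, C : ∀ p < p_c,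
∃ S ∋ 0 finite, |S| ≤ C (p_c − p)^{−γ₀} ∧ φ_p(S) ≤ 1 − η`. Sufficient: `CriterionBoxScaleBelowOne`
(`ν₀ < 1` for the finite-size correlation length; `criterionVolume_of_boxScale`). By
`DCT16_phi_mono_holds` it is enough to produce the sets for `p` in a left neighbourhood
`(p_c − δ₀, p_c)` (a criterion set at `p₀` serves every `p ≤ p₀`, and `(p_c − p)^{−γ₀} ≥ 1`).
Why it might fail: it is false iff the volume exponent of DCT criterion sets on `ℤ³` is `≥ 3`
(numerics: `3ν ≈ 2.63`); no polynomial bound whatsoever is known (DKT 2020 Thm 2: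
`ξ_p ≤ exp(C (p_c−p)^{−2})`, arXiv:1902.03207); lower bounds: volume exponent `≥ 1`
(Aizenman–Newman `γ ≥ 1` + STUB 1), `≥ 2` in a jump world (Newman 1986, doi:10.1007/bf01021076).
Nearest existing item: `PercReliabilityThinning.NuSupLtOne` (stmt-CriticalPhenomena-11744: axis
two-point decay `τ_p(0, n e₁) ≤ exp(−(p_c − p)^{ν'} n / C)`, `ν' < 1`, near `p_c`), which IMPLIES
the box form: the axis rate bounds `1/ξ(p)` from below (supermultiplicativity), Grimmett 1999
Prop. (6.47)/(6.48) p.127 gives `τ_p(0,x) ≤ e^{−‖x‖_∞/ξ(p)}` for all `x`, hence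
`φ_p(Λ_L) ≤ 3 |∂Λ_L| e^{−L/ξ(p)} ≤ 18 (2L+1)² e^{−L/ξ(p)} ≤ 1/2` once `L ≥ 3 ξ(p) log(C'ξ(p))`,
i.e. `L(p) ≤ C″ (p_c − p)^{−ν₀}` for every `ν₀ ∈ (ν', 1)` (the logarithm costs an arbitrarily
small exponent). So closing stmt-11744 closes this stub up to STUB-1-type bookkeeping. -/
theorem stub_criterionVolume : CriterionVolumeBelowCube := by
  sorry

/-! ### Name-keyed aliases of the stub statements
`__Registered.stub_X` is statement `X` under the registered stub's short name, so that the native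
skeleton audit (hypotheses admissible iff registered stubs BY NAME) accepts
`SubcritChiBelowCube_of : __Registered.stub_… → … → SubcritChiBelowCube` (device of
`Cruxes/BGNOffTheFloor/Lines/birth.lean`; the `@[stub]` attribute is gate-reserved). -/
namespace __Registered

/-- Alias of `SimonLiebBound` keyed by the registered stub name. -/
abbrev stub_simonLieb : Prop := SimonLiebBound
/-- Alias of `CriterionVolumeBelowCube` keyed by the registered stub name. -/
abbrev stub_criterionVolume : Prop := CriterionVolumeBelowCube

end __Registered

/-! ## Proved plumbing -/

theorem pc_pos : 0 < pc := criticalProb_zd_pos 3 (by norm_num)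

theorem pc_lt_one : pc < 1 := criticalProb_zd_lt_one (d := 3) (by norm_num)

/-- For `p < p_c` the base `p_c − p` of the power law lies in `(0, 1]`. -/
theorem base_mem_Ioc (p : unitInterval) (hp : (p : ℝ) < pc) :
    0 < pc - (p : ℝ) ∧ pc - (p : ℝ) ≤ 1 :=
  ⟨sub_pos.2 hp, (sub_le_self _ p.2.1).trans pc_lt_one.le⟩

/-- Hence `(p_c − p)^{−a} ≥ 1` for `a ≥ 0`. -/
theorem one_le_base_rpow_neg (p : unitInterval) (hp : (p : ℝ) < pc) {a : ℝ} (ha : 0 ≤ a) :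
    1 ≤ (pc - (p : ℝ)) ^ (-a) :=
  Real.one_le_rpow_of_pos_of_le_one_of_nonpos (base_mem_Ioc p hp).1 (base_mem_Ioc p hp).2
    (neg_nonpos.2 ha)

theorem chiR_nonneg (p : unitInterval) (R : ℕ) : 0 ≤ chiR p R :=
  Finset.sum_nonneg fun _ _ => measureReal_nonneg

/-- The trivial volume bound `χ_R(p) ≤ |Λ_R| = (2R+1)³`. -/
theorem chiR_le_card (p : unitInterval) (R : ℕ) : chiR p R ≤ ((box 3 R).card : ℝ) := by
  unfold chiR
  calc ∑ x ∈ box 3 R, (bondPercolation (zdGraph 3) p).real (openConn (0 : Site 3) x)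
      ≤ ∑ _x ∈ box 3 R, (1 : ℝ) := Finset.sum_le_sum fun _ _ => measureReal_le_one
    _ = ((box 3 R).card : ℝ) := by simp

/-- `|Λ_L| = (2L+1)³` as a real number. -/
theorem card_box_three (L : ℕ) : ((box 3 L).card : ℝ) = (2 * (L : ℝ) + 1) ^ 3 := by
  rw [card_box]; push_cast; ring

/-- **The correlation-length form implies STUB 2**: criterion boxes at scale
`L(p) ≤ C (p_c − p)^{−ν₀}`, `0 ≤ ν₀ < 1`, are criterion sets of volume
`(2L+1)³ ≤ (2|C|+1)³ (p_c − p)^{−3ν₀}`, and `3ν₀ < 3`. -/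
theorem criterionVolume_of_boxScale (h : CriterionBoxScaleBelowOne) : CriterionVolumeBelowCube := by
  obtain ⟨ν₀, η, C, hν0, hν1, hη, h⟩ := h
  refine ⟨3 * ν₀, η, (2 * |C| + 1) ^ 3, by linarith, hη, fun p hp => ?_⟩
  obtain ⟨L, hL, hφ⟩ := h p hp
  refine ⟨box 3 L, zero_mem_box 3 L, ?_, hφ⟩
  have ht0 : 0 < pc - (p : ℝ) := (base_mem_Ioc p hp).1
  set s : ℝ := (pc - (p : ℝ)) ^ (-ν₀) with hs
  have hs1 : 1 ≤ s := one_le_base_rpow_neg p hp hν0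
  have hLs : (L : ℝ) ≤ |C| * s :=
    hL.trans (mul_le_mul_of_nonneg_right (le_abs_self C) (zero_le_one.trans hs1))
  have h2L : 2 * (L : ℝ) + 1 ≤ (2 * |C| + 1) * s := by nlinarith [abs_nonneg C]
  have hpow : (2 * (L : ℝ) + 1) ^ 3 ≤ ((2 * |C| + 1) * s) ^ 3 :=
    pow_le_pow_left₀ (by positivity) h2L 3
  have hs3 : s ^ 3 = (pc - (p : ℝ)) ^ (-(3 * ν₀)) := by
    rw [hs, ← Real.rpow_natCast, ← Real.rpow_mul ht0.le]
    congr 1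
    push_cast
    ring
  rw [card_box_three]
  calc (2 * (L : ℝ) + 1) ^ 3 ≤ ((2 * |C| + 1) * s) ^ 3 := hpow
    _ = (2 * |C| + 1) ^ 3 * s ^ 3 := by ring
    _ = (2 * |C| + 1) ^ 3 * (pc - (p : ℝ)) ^ (-(3 * ν₀)) := by rw [hs3]

/-! ## The composition, by name -/

/-- **`SubcritChiBelowCube_of`**: the two registered stubs imply the crux
`Summit.CriticalPhenomena.PercolationContinuityZ3.Theses.PercDebrisSweep.SubcritChiBelowCube`
(kernel-checked; no `sorry` outside the stubs): for `p < p_c` pick the criterion set `S(p)` of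
STUB 2 and apply STUB 1: `χ_R(p) ≤ |S(p)|/η ≤ (C/η) (p_c − p)^{−γ₀}`; witness `(γ, C') = (γ₀, C/η)`. -/
theorem SubcritChiBelowCube_of (hSL : __Registered.stub_simonLieb)
    (hvol : __Registered.stub_criterionVolume) :
    Summit.CriticalPhenomena.PercolationContinuityZ3.Theses.PercDebrisSweep.SubcritChiBelowCube := by
  rw [subcritChiBelowCube_iff]
  obtain ⟨γ₀, η, C, hγ, hη, hcrit⟩ := hvol
  refine ⟨γ₀, C / η, hγ, fun p hp R => ?_⟩
  obtain ⟨S, h0S, hcard, hφ⟩ := hcrit p hp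
  calc chiR p R ≤ (S.card : ℝ) / η := hSL p S η h0S hη hφ R
    _ ≤ C * (pc - (p : ℝ)) ^ (-γ₀) / η := div_le_div_of_nonneg_right hcard hη.le
    _ = C / η * (pc - (p : ℝ)) ^ (-γ₀) := by ring

/- Entry point for provers of STUB 2 (not a second theorem concluding the crux, so that the native
skeleton audit sees exactly one composition): from the correlation-length form one gets the crux as
`SubcritChiBelowCube_of hSL (criterionVolume_of_boxScale hbox)` for `hSL : SimonLiebBound`,
`hbox : CriterionBoxScaleBelowOne`. -/

/-- Wiring check: the registered stubs feed `SubcritChiBelowCube_of` as stated. -/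
example : Summit.CriticalPhenomena.PercolationContinuityZ3.Theses.PercDebrisSweep.SubcritChiBelowCube :=
  SubcritChiBelowCube_of stub_simonLieb stub_criterionVolume

end Summit.CriticalPhenomena.PercolationContinuityZ3.Cruxes.SubcritChiBelowCube.Birth

end
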